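import Mathlib
import Summits.ResolutionOfSingularities.ResolutionOfSingularities.Theorems.RadicialJungCleanModelsBirthDerivation
import Summits.ResolutionOfSingularities.ResolutionOfSingularities.Theorems.RadicialJungCleanModelsBirthCorner
import Literature.FieldTheory.Separability.PIndependentDerivations
import HarnessLib

/-!
# Route `RadicialJung`, crux `CleanModels` (stmt-ResolutionOfSingularities-15917), line `Sketch` rev 35, stub 6 `stub_cleanProp44` (X44c),
# `τ = 1` residual, the corner `λ' ≡ 0` ((B5′)): THE UNCONDITIONAL BIRTH COUNT — arithmetic derivations exist (tree ✓ `exists_derivation_eq_one_eqOn_zero`)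

Seat decomp-res-hand-2 g12 (structural hand); sixth brick, closing the kernel side of the corner at NON-RATIONAL points.  ✓ `…BirthDerivation.lean`
counted the births of `F ∈ κ[u]` with ANY derivation `D` of `κ[u]` such that `D F ≠ 0`, `deg D F ≤ δ'`, and instantiated `D = ∂ ⊗ 1`
(`Differential.mapCoeffs`) for a differential structure on `κ` moving a coefficient of `F` — leaving the EXISTENCE of such an arithmetic derivation `∂`
(the `p`-basis theorem, Matsumura §26) as a datum.  The tree already holds that theorem: ✓ `Literature.FieldTheory.Separability.exists_derivation_eq_one_eqOn_zero`
(Zorn along `p`-th root extensions; [cite: Matsumura1987, §26 p. 202]).  Hence: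

* `births_exists_coeff_not_pow_of_ne_pow` — in the corner (`F' = 0`), `F ∉ κ[u]^p ⟹` some coefficient of `F` is not a `p`-th power (`F ∉ κ^p[u]`).
* `births_corner_count` — **THE UNCONDITIONAL COUNT**: `κ` any field of characteristic `p`, `F ∈ κ[u]` with a coefficient outside `κ^p`; over pairwise coprime
  `π_i` with `π_i^{n_i} ∣ F − G_i^p`: `Σ_i (n_i − 1)·deg π_i ≤ deg F` (`≤ δ`).  No hypothesis on `F'`, on separability of the points, or on `κ`.
* `births_corner_lt_of_two_le_natDegree_of_coeff` — strict descent `n < deg F` at every closed point of degree `≥ 2` once `deg F ≥ 3`;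
  `births_corner_count_of_ne_pow` / `births_corner_lt_of_ne_pow` — the same from the corner hypotheses `F' = 0`, `F ∉ κ[u]^p` of ✓ `…BirthCorner.lean`.

NET for the planner (with ✓ BirthDescent/BirthCorner/BirthCornerSeparable/BirthDerivation/BirthChains): the algebra and combinatorics of the births termination
(B′) of memo 4e §2.5–2.6 are kernel-checked for EVERY residue field with NO external input; what is by hand is the dictionary (memo hand2-g12 §2) and the
(B5″) straightening/algebraization argument (§4 (c)).  Honest framing: OURS; nothing here proves (B′), the hypotheses of `cleanProp44_of_tauOneResidual`, X44c,
any case of `CleanModels`, or resolution of singularities in characteristic `p`.  Setting only: [cite: CossartPiltant2008, Lemma 4.3 (5), Prop. 4.4]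
[cite: CossartJannsenSaito2020, Thm. 4.22, Cor. 4.23].
-/

set_option linter.dupNamespace false -- mandated namespace of this single-conjunct summit

open Polynomial Finset
open Literature.FieldTheory.Separability

namespace Summit.ResolutionOfSingularities.ResolutionOfSingularities.Theorems.RadicialJung.CleanModels

/-! ## §1 In the corner some coefficient is not a `p`-th power -/

/-- **`F' = 0`, `F ∉ κ[u]^p ⟹ F ∉ κ^p[u]`**: if every coefficient of `F` were a `p`-th power, `F = expand_p(contract_p F)` would be the `p`-th power of
the polynomial with the `p`-th roots as coefficients. [folklore] -/
theorem births_exists_coeff_not_pow_of_ne_pow {K : Type*} [Field K] (p : ℕ) [Fact p.Prime] [CharP K p] {F : K[X]}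
    (hF' : derivative F = 0) (hnot : ∀ H : K[X], F ≠ H ^ p) : ∃ i, ∀ y : K, y ^ p ≠ F.coeff i := by
  by_contra hall
  push Not at hall
  choose y hy using hall
  have hp : p.Prime := Fact.out
  set Φ := contract p F with hΦdef
  have hΦ : expand K p Φ = F := expand_contract p hF' hp.ne_zero
  -- `Φ = frob (Σ C (y (p j)) X^j)`
  set H : K[X] := ∑ j ∈ Finset.range (Φ.natDegree + 1), C (y (p * j)) * X ^ j with hHdef
  have hmapH : map (frobenius K p) H = Φ := by
    rw [hHdef, Polynomial.map_sum]
    conv_rhs => rw [as_sum_range_C_mul_X_pow Φ]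
    refine Finset.sum_congr rfl fun j _ => ?_
    rw [Polynomial.map_mul, Polynomial.map_pow, map_C, map_X, frobenius_def, hy, hΦdef, coeff_contract hp.ne_zero, Nat.mul_comm p j]
  apply hnot H
  rw [← hΦ, ← hmapH, ← map_expand, map_frobenius_expand]

/-! ## §2 The unconditional count -/

/-- **THE UNCONDITIONAL BIRTH COUNT IN THE CORNER**: `κ` a field of characteristic `p`, `F ∈ κ[u]` with some coefficient not a `p`-th power; for every family
of pairwise coprime `π_i` and exponents with `π_i^{n_i} ∣ F − G_i^p`, `Σ_i (n_i − 1)·deg π_i ≤ deg F`.  (An arithmetic derivation `∂` of `κ` with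
`∂(F_i) = 1` exists by the tree's ✓ `exists_derivation_eq_one_eqOn_zero` applied to the subfield `κ^p` of `p`-th powers; then ✓ `births_corner_count_mapCoeffs`.)
[cite: Matsumura1987, §26 p. 202] -/
theorem births_corner_count {K : Type*} [Field K] (p : ℕ) [Fact p.Prime] [CharP K p] {F : K[X]}
    (hF : ∃ i, ∀ y : K, y ^ p ≠ F.coeff i)
    {ι : Type*} (s : Finset ι) (π : ι → K[X]) (hcop : (s : Set ι).Pairwise (Function.onFun IsCoprime π))
    (n : ι → ℕ) (G : ι → K[X]) (hdvd : ∀ i ∈ s, π i ^ n i ∣ F - G i ^ p) :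
    ∑ i ∈ s, (n i - 1) * (π i).natDegree ≤ F.natDegree := by
  obtain ⟨i, hi⟩ := hF
  have hmem : ∀ x : K, x ^ p ∈ (frobenius K p).fieldRange := fun x => RingHom.mem_fieldRange.mpr ⟨x, frobenius_def ..⟩
  have hb : F.coeff i ∉ (frobenius K p).fieldRange := by
    intro h
    obtain ⟨y, hy⟩ := RingHom.mem_fieldRange.mp h
    exact hi y (by rw [← frobenius_def, hy])
  obtain ⟨D, hD1, -⟩ := exists_derivation_eq_one_eqOn_zero p (frobenius K p).fieldRange hmem hb
  letI : Differential K := ⟨D⟩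
  refine births_corner_count_mapCoeffs p ⟨i, ?_⟩ s π hcop n G hdvd
  show D (F.coeff i) ≠ 0
  rw [hD1]
  exact one_ne_zero

/-- **Strict descent at every point of degree `≥ 2`, unconditionally**: with `F` as above and `deg F ≥ 3`, a closed point `π` of degree `≥ 2` (separable or
inseparable) with `π^n ∣ F − G^p` has `n < deg F`. [cite: Matsumura1987, §26 p. 202] -/
theorem births_corner_lt_of_two_le_natDegree_of_coeff {K : Type*} [Field K] (p : ℕ) [Fact p.Prime] [CharP K p] {F : K[X]}
    (hF : ∃ i, ∀ y : K, y ^ p ≠ F.coeff i) (h3 : 3 ≤ F.natDegree)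
    {π G : K[X]} (h2 : 2 ≤ π.natDegree) {n : ℕ} (hn : π ^ n ∣ F - G ^ p) : 2 * (n - 1) ≤ F.natDegree ∧ n < F.natDegree := by
  have h := births_corner_count p hF ({()} : Finset Unit) (fun _ => π) (by simp [Set.Pairwise]) (fun _ => n) (fun _ => G)
    (fun _ _ => hn)
  rw [Finset.sum_singleton] at h
  have h' : 2 * (n - 1) ≤ F.natDegree :=
    calc 2 * (n - 1) = (n - 1) * 2 := mul_comm _ _
      _ ≤ (n - 1) * π.natDegree := Nat.mul_le_mul_left _ h2
      _ ≤ F.natDegree := h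
  exact ⟨h', by omega⟩

/-! ## §3 From the corner hypotheses of `…BirthCorner.lean` -/

/-- The count in the corner `F' = 0`, `F ∉ κ[u]^p` (the hypotheses of ✓ `births_corner_not_dvd` / `births_corner_unique`). [cite: Matsumura1987, §26 p. 202] -/
theorem births_corner_count_of_ne_pow {K : Type*} [Field K] (p : ℕ) [Fact p.Prime] [CharP K p] {F : K[X]}
    (hF' : derivative F = 0) (hnot : ∀ H : K[X], F ≠ H ^ p)
    {ι : Type*} (s : Finset ι) (π : ι → K[X]) (hcop : (s : Set ι).Pairwise (Function.onFun IsCoprime π))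
    (n : ι → ℕ) (G : ι → K[X]) (hdvd : ∀ i ∈ s, π i ^ n i ∣ F - G i ^ p) :
    ∑ i ∈ s, (n i - 1) * (π i).natDegree ≤ F.natDegree :=
  births_corner_count p (births_exists_coeff_not_pow_of_ne_pow p hF' hnot) s π hcop n G hdvd

/-- Strict descent at points of degree `≥ 2` in the corner `F' = 0`, `F ∉ κ[u]^p`, `deg F ≥ 3`. [cite: Matsumura1987, §26 p. 202] -/
theorem births_corner_lt_of_ne_pow {K : Type*} [Field K] (p : ℕ) [Fact p.Prime] [CharP K p] {F : K[X]}
    (hF' : derivative F = 0) (hnot : ∀ H : K[X], F ≠ H ^ p) (h3 : 3 ≤ F.natDegree)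
    {π G : K[X]} (h2 : 2 ≤ π.natDegree) {n : ℕ} (hn : π ^ n ∣ F - G ^ p) : n < F.natDegree :=
  (births_corner_lt_of_two_le_natDegree_of_coeff p (births_exists_coeff_not_pow_of_ne_pow p hF' hnot) h3 h2 hn).2

end Summit.ResolutionOfSingularities.ResolutionOfSingularities.Theorems.RadicialJung.CleanModels
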